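import Summits.RiemannHypothesis.RiemannHypothesis.Theorems.TiltedLandingLaw421Seam09

/-! # TiltedLandingLaw421 — descent seam, part 10
Token-identical port of the descent framework of `Cruxes/TiltedLandingLaw421/Lines/law421birthS.lean`
(seam canon ce03e18b) into flat Theorems modules, so that crux line files can import it instead of inlining it.
No new mathematics; no `sorry`; no route (Theses) imports — the tree statement is mirrored as `RhW07.Seam.Law421Statement`. -/

open Complex Metric Set
open scoped ComplexConjugate
namespace RhIdea6.G20.W07C12.StColP
open Set Complex
open RhIdea6.G17.W07C7 RhIdea6.G17.W07C7.Rev6 RhIdea6.G18.W07C8.Law421BirthS RhIdea6.G19.W07C11.Seam RhIdea6.G20.W07C12.Frac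

/-- `fracLinP_of_stop` — seam of the TiltedLandingLaw421 descent framework, part 10 (token-identical port of `Cruxes/TiltedLandingLaw421/Lines/law421birthS.lean`; no new mathematics). -/
theorem fracLinP_of_stop (h : SurplusLiftSigStop (1 / 4) 1) : FracLinP :=
  fracCensusLinP_of_stop (by norm_num) h

/-- `law421T_of_fracLinP` — seam of the TiltedLandingLaw421 descent framework, part 10 (token-identical port of `Cruxes/TiltedLandingLaw421/Lines/law421birthS.lean`; no new mathematics). -/
private theorem law421T_of_fracLinP (h : FracLinP) (hHer : AnalyticHereditySig) :
    RhW07.Seam.Law421Statement :=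
  law421T_ofS' (descentSigS'_of_fracLinP h) hHer

/-- `law421T_of_fracLQP` — seam of the TiltedLandingLaw421 descent framework, part 10 (token-identical port of `Cruxes/TiltedLandingLaw421/Lines/law421birthS.lean`; no new mathematics). -/
private theorem law421T_of_fracLQP (h : FracLQP) (hHer : AnalyticHereditySig) :
    RhW07.Seam.Law421Statement :=
  law421T_ofS' (descentSigS'_of_fracLQP h) hHer

end RhIdea6.G20.W07C12.StColP
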